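import Literature.NumberTheory.EllipticCurves.PrimaryTorsionLocalCocycleInertiaValuesProofs
import Literature.NumberTheory.EllipticCurves.PrimaryTorsionLocalH1InertiaRestrictionProofs
import Literature.NumberTheory.GaloisRepresentations.TameInertiaKummerProofs
import HarnessLib

/-!
# `H¹(K_w, E[p^∞])` is FINITE at a place `w ∤ p` of good reduction, of order at most
# `#{y ∈ E[p^∞] : #Ẽ_w(k_w)·y = 0, Frob_w y = q_w y}` — PROVED (tame inertia is pro-cyclic)

Topic `NumberTheory/EllipticCurves`; namespace `WeierstrassCurve`. THEOREMS ONLY (no definition, no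
named fact, no instance, no `sorry`; D-0026). Cell `bsd-stepL` (typer lane `defn-ty1`, g9): step C2b of
module L4a of the discharge plan for the named LOCAL fact
`JetchevSkinnerWan2017.sigmaLocal_charIdeal_eulerFactor_mem_of_noTamagawaDefect`
(`HOME/defn-ty1/g9/NOTE-sigmaLocal-discharge-plan-defn-ty1-g9.md`, §UPDATE 2, ROUTE T).

[GreenbergLNM1716] §2 (p. 71): for `v ∤ p` of good reduction, `H¹(K_v, E[p^∞])` is finite (of order
`#E(K_v)[p^∞]`).  Mechanism here: restriction to inertia is injective
(`resSubgroup_absInertia_injective_primaryTorsion`), a local cocycle is an additive function on `I_w`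
killing wild inertia with values in the finite set `{y : #Ẽ_w(k_w) y = 0, Frob_w y = q_w y}`
(`PrimaryTorsionLocalCocycleInertiaValuesProofs`), and every TAME quotient of `I_w` of exponent prime
to `ℓ` is cyclic ([SerreLocalFields1979] IV §2 Cor. 1 of Prop. 7, the tree's
`absInertia_exists_eq_mul_zpow`): so any finite family of classes is detected by the values of
representatives at ONE element `g ∈ I_w`.

## What is proved

For an elliptic curve `W` over a number field `K` (`K : Type`), a prime `p`, a finite place `w ∤ p`
of good reduction, the local Galois group `Γ_{K_w}` acting on `E[p^∞]` through
`absGaloisRestrict K K_w` (= `localMap K (Sum.inl w)`), an arithmetic Frobenius lift `φ`: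
* `cocycle_apply_zpow_of_mem_absInertia` — `z(σⁿ) = n·z(σ)` on inertia, `n ∈ ℤ`;
* `finset_card_le_natCard_target` — every finite set of classes of `H¹(K_w, E[p^∞])` has at most
  `#T` elements, `T = {y ∈ E[p^∞] | #Ẽ_w(k_w)·y = 0 ∧ ρ(φ) y = q_w·y}` (finite);
* **`finite_h1_primaryTorsion`**, **`natCard_h1_primaryTorsion_le`** — `H¹(K_w, E[p^∞])` is finite
  and `#H¹(K_w, E[p^∞]) ≤ #T`.

HONEST FRAMING: the comparison `#T ≤ #E(K_w)[p^∞]` (Weil-pairing count, files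
`TorsionFrobeniusWeilPairingAnnihilatorProofs`, `TorsionFrobeniusKernelCountProofs`) and the final
divisibility are NOT in this file; the named fact is NOT discharged here.

References: [GreenbergLNM1716] §2 (p. 71); [SerreLocalFields1979] Ch. IV §2 (Cor. 1, 3 of Prop. 7);
[SerreInventiones1972] §1.3; [Rubin2000] Lemma 1.3.2, §1.3. Tree: `TameInertiaKummerProofs`
(`absInertia_exists_eq_mul_zpow`, `exists_isGalois_mem_of_restrict_eq_one`),
`ContinuousCohomologyBockstein` (`oneCocycleKer`), files C1/C2 of this lane.
-/

noncomputable section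

open scoped Classical
open CategoryTheory Field ValuativeRel NumberField IsDedekindDomain IsDedekindDomain.HeightOneSpectrum
open Literature.NumberTheory.EllipticCurves Literature.NumberTheory.EllipticCurves.BigGaloisRep
  Literature.NumberTheory.GaloisRepresentations Literature.NumberTheory.Automorphic
  Literature.NumberTheory.GaloisRepresentations.IsNonarchimedeanLocalField

namespace WeierstrassCurve

variable {K : Type} [Field K] [NumberField K] (W : WeierstrassCurve K) [W.IsElliptic]
  (p : ℕ) [Fact p.Prime] {w : HeightOneSpectrum (𝓞 K)} [ContinuousSMul ℤ_[p] (PrimaryTorsion (geomPoints W) p)]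

/-- `z(σ⁻¹) = −z(σ)` on inertia. [cite: SerreGaloisCohomology1997, I §2.2] -/
theorem cocycle_apply_inv_of_mem_absInertia (hw : ((p : ℕ) : 𝓞 K) ∉ w.asIdeal)
    (hgood : W.HasGoodReductionAt w)
    (z : contOneCocycles ((W.primaryTorsionGaloisRep p).restrict
      (absGaloisRestrict K (w.adicCompletion K))).toTopRep)
    {σ : absoluteGaloisGroup (w.adicCompletion K)} (hσ : σ ∈ absInertia (w.adicCompletion K)) :
    z.1 σ⁻¹ = -z.1 σ := by
  have h := W.cocycle_apply_mul_of_mem_absInertia p hw hgood z hσ σ⁻¹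
  rw [mul_inv_cancel, contOneCocycles.apply_one] at h
  rw [eq_neg_iff_add_eq_zero, add_comm]
  exact h.symm

/-- `z(σⁿ) = n·z(σ)` on inertia for `n ∈ ℤ`. [cite: SerreGaloisCohomology1997, I §2.2] -/
theorem cocycle_apply_zpow_of_mem_absInertia (hw : ((p : ℕ) : 𝓞 K) ∉ w.asIdeal)
    (hgood : W.HasGoodReductionAt w)
    (z : contOneCocycles ((W.primaryTorsionGaloisRep p).restrict
      (absGaloisRestrict K (w.adicCompletion K))).toTopRep)
    {σ : absoluteGaloisGroup (w.adicCompletion K)} (hσ : σ ∈ absInertia (w.adicCompletion K))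
    (n : ℤ) : z.1 (σ ^ n) = n • z.1 σ := by
  cases n with
  | ofNat n => rw [Int.ofNat_eq_natCast, zpow_natCast, natCast_zsmul,
      W.cocycle_apply_pow_of_mem_absInertia p hw hgood z hσ n]
  | negSucc n =>
    rw [zpow_negSucc, W.cocycle_apply_inv_of_mem_absInertia p hw hgood z (pow_mem hσ _),
      W.cocycle_apply_pow_of_mem_absInertia p hw hgood z hσ, negSucc_zsmul]

omit [ContinuousSMul ℤ_[p] (PrimaryTorsion (geomPoints W) p)] in
/-- The target set `T = {y ∈ E[p^∞] | #Ẽ_w(k_w)·y = 0 ∧ ρ(φ) y = q_w·y}` of the values of local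
cocycles on inertia is finite (it embeds in the `#Ẽ_w(k_w)`-torsion of `E(K̄)`, finite:
`finite_torsionPoints_holds`). [cite: SilvermanAEC2009, Cor. III.6.4] -/
theorem finite_target (φ : absoluteGaloisGroup (w.adicCompletion K)) :
    Finite {y : PrimaryTorsion (geomPoints W) p //
      Nat.card (W.reductionAt w).toAffine.Point • y = 0 ∧
        W.primaryTorsionGaloisRep p (absGaloisRestrict K (w.adicCompletion K) φ) y =
          (Nat.card (IsLocalRing.ResidueField (w.adicCompletionIntegers K)) : ℤ) • y} := by
  haveI : Finite (IsLocalRing.ResidueField (w.adicCompletionIntegers K)) :=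
    finite_residueField_adicCompletionIntegers K w
  haveI := finite_point (W.reductionAt w)
  haveI : Nonempty (W.reductionAt w).toAffine.Point := ⟨.zero⟩
  have hN : ((Nat.card (W.reductionAt w).toAffine.Point : ℕ) : ℤ) ≠ 0 := by
    exact_mod_cast (Nat.card_pos (α := (W.reductionAt w).toAffine.Point)).ne'
  haveI : Finite (geomTorsion W (Nat.card (W.reductionAt w).toAffine.Point : ℤ)) :=
    finite_torsionPoints_holds W (AlgebraicClosure K) hN
  refine Finite.of_injective (fun y ↦ (⟨(y.1 : geomPoints W), ?_⟩ :
    geomTorsion W (Nat.card (W.reductionAt w).toAffine.Point : ℤ))) ?_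
  · refine (Submodule.mem_torsionBy_iff _ _).2 ?_
    change ((Nat.card (W.reductionAt w).toAffine.Point : ℕ) : ℤ) • (y.1 : geomPoints W) = 0
    rw [natCast_zsmul, ← PrimaryTorsion.val_nsmul, y.2.1, PrimaryTorsion.val_zero]
  · intro y y' h
    exact Subtype.ext (PrimaryTorsion.ext (congrArg (fun t ↦ (t.1 : geomPoints W)) h))

/-- **Any finite family of classes of `H¹(K_w, E[p^∞])` (good `w ∤ p`) is detected by the value of
representatives at ONE element of inertia**, hence has at most `#T` members: for a finite set `S` of
classes with representatives `z_x`, the subgroup `N = {τ ∈ I_w | z_x(τ) = 0 ∀ x ∈ S}` contains all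
`d`-th powers (`d` a power of `p` killing the values) and the kernel of a finite Galois level (the zero
loci are open), so `I_w = N·⟨g⟩` for some `g` (`absInertia_exists_eq_mul_zpow`: tame quotients of
inertia are cyclic); then `x ↦ z_x(g) ∈ T` is injective on `S` (restriction to inertia is injective,
`resSubgroup_absInertia_injective_primaryTorsion`).
[cite: SerreLocalFields1979, Ch. IV §2 Cor. 1 and Cor. 3 of Prop. 7] [cite: GreenbergLNM1716, §2 (p. 71)] -/
theorem finset_card_le_natCard_target (hw : ((p : ℕ) : 𝓞 K) ∉ w.asIdeal)
    (hgood : W.HasGoodReductionAt w) {φ : absoluteGaloisGroup (w.adicCompletion K)}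
    (hφ : IsFrobPow φ 1)
    (S : Finset (continuousCohomology 1 ((W.primaryTorsionGaloisRep p).restrict
      (absGaloisRestrict K (w.adicCompletion K))).toTopRep)) :
    S.card ≤ Nat.card {y : PrimaryTorsion (geomPoints W) p //
      Nat.card (W.reductionAt w).toAffine.Point • y = 0 ∧
        W.primaryTorsionGaloisRep p (absGaloisRestrict K (w.adicCompletion K) φ) y =
          (Nat.card (IsLocalRing.ResidueField (w.adicCompletionIntegers K)) : ℤ) • y} := by
  haveI := W.finite_target p φ (w := w)
  -- representatives
  choose z hz using oneCocycleClass_surjective ((W.primaryTorsionGaloisRep p).restrict (absGaloisRestrict K (w.adicCompletion K))).toTopRep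
  -- values on inertia lie in the finite target `T`
  have hval : ∀ (x : continuousCohomology 1 ((W.primaryTorsionGaloisRep p).restrict (absGaloisRestrict K (w.adicCompletion K))).toTopRep) {σ : absoluteGaloisGroup (w.adicCompletion K)},
      σ ∈ absInertia (w.adicCompletion K) → Nat.card (W.reductionAt w).toAffine.Point • (z x).1 σ = 0 ∧
        W.primaryTorsionGaloisRep p (absGaloisRestrict K (w.adicCompletion K) φ) ((z x).1 σ) =
          (Nat.card (IsLocalRing.ResidueField (w.adicCompletionIntegers K)) : ℤ) • (z x).1 σ := fun x σ hσ ↦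
    ⟨by rw [← natCast_zsmul]; exact W.natCard_point_smul_cocycle_apply_eq_zero p hw hgood (z x) hσ, by
      rw [W.frob_apply_cocycle_apply_eq_residueCard_smul p hw hgood (z x) hφ hσ,
        residueFieldCard_adicCompletion_eq K w, natCard_residueField_adicCompletionIntegers_eq_absNorm]
      rfl⟩
  -- a uniform `p`-power `d = p ^ k₀` killing the target
  obtain ⟨k₀, hk₀⟩ := Finite.exists_le (fun y : {y : PrimaryTorsion (geomPoints W) p //
      Nat.card (W.reductionAt w).toAffine.Point • y = 0 ∧
        W.primaryTorsionGaloisRep p (absGaloisRestrict K (w.adicCompletion K) φ) y =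
          (Nat.card (IsLocalRing.ResidueField (w.adicCompletionIntegers K)) : ℤ) • y} ↦
    (PrimaryTorsion.exists_pow_smul_eq_zero y.1).choose)
  have hkill : ∀ y : {y : PrimaryTorsion (geomPoints W) p //
      Nat.card (W.reductionAt w).toAffine.Point • y = 0 ∧
        W.primaryTorsionGaloisRep p (absGaloisRestrict K (w.adicCompletion K) φ) y =
          (Nat.card (IsLocalRing.ResidueField (w.adicCompletionIntegers K)) : ℤ) • y},
      p ^ k₀ • (y.1 : PrimaryTorsion (geomPoints W) p) = 0 := fun y ↦ by
    have hy := (PrimaryTorsion.exists_pow_smul_eq_zero y.1).choose_spec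
    have hle := hk₀ y
    apply PrimaryTorsion.ext
    rw [PrimaryTorsion.val_nsmul, ← Nat.sub_add_cancel hle, pow_add, mul_smul, hy, smul_zero,
      PrimaryTorsion.val_zero]
  -- the subgroup `N` of inertia on which all representatives of `S` vanish
  let N : Subgroup ↥(absInertia (w.adicCompletion K)) :=
    { carrier := {τ | ∀ x ∈ S, (z x).1 (τ : absoluteGaloisGroup (w.adicCompletion K)) = 0}
      one_mem' := fun x _ ↦ contOneCocycles.apply_one (z x)
      mul_mem' := fun {a b} ha hb x hx ↦ by
        change (z x).1 ((a : absoluteGaloisGroup (w.adicCompletion K)) * b) = 0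
        rw [W.cocycle_apply_mul_of_mem_absInertia p hw hgood (z x) a.2, ha x hx, hb x hx, add_zero]
      inv_mem' := fun {a} ha x hx ↦ by
        change (z x).1 ((a : absoluteGaloisGroup (w.adicCompletion K))⁻¹) = 0
        rw [W.cocycle_apply_inv_of_mem_absInertia p hw hgood (z x) a.2, ha x hx, neg_zero] }
  have hNmem : ∀ τ : ↥(absInertia (w.adicCompletion K)), τ ∈ N ↔ ∀ x ∈ S, (z x).1 (τ : absoluteGaloisGroup (w.adicCompletion K)) = 0 :=
    fun τ ↦ Iff.rfl
  -- `d`-th powers lie in `N`, `d = p ^ k₀` prime to `ℓ`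
  have hℓ : ¬ ringChar 𝓀[w.adicCompletion K] ∣ p ^ k₀ := fun h ↦
    w.ringChar_residueField_adicCompletion_ne hw
      (((Nat.prime_dvd_prime_iff_eq ringChar_residueField_prime (Fact.out : p.Prime)).mp
        (ringChar_residueField_prime.dvd_of_dvd_pow h)))
  have hNd : ∀ τ : ↥(absInertia (w.adicCompletion K)), τ ^ (p ^ k₀) ∈ N := fun τ x hx ↦ by
    rw [Subgroup.coe_pow, W.cocycle_apply_pow_of_mem_absInertia p hw hgood (z x) τ.2]
    exact hkill ⟨(z x).1 τ, hval x τ.2⟩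
  -- a finite Galois level whose kernel lies in all the (open) zero loci
  have hU : IsOpen (⋂ x ∈ S, (oneCocycleKer (z x) : Set (absoluteGaloisGroup (w.adicCompletion K)))) :=
    isOpen_biInter_finset fun x _ ↦ isOpen_oneCocycleKer (z x)
  have h1U : (1 : absoluteGaloisGroup (w.adicCompletion K)) ∈
      ⋂ x ∈ S, (oneCocycleKer (z x) : Set (absoluteGaloisGroup (w.adicCompletion K))) := by
    simp only [Set.mem_iInter, SetLike.mem_coe]
    exact fun x _ ↦ (oneCocycleKer (z x)).one_mem
  obtain ⟨E, hEfd, hEgal, hE⟩ := exists_isGalois_mem_of_restrict_eq_one (w.adicCompletion K) hU h1U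
  haveI := hEfd
  haveI := hEgal
  have hNE : ∀ τ : ↥(absInertia (w.adicCompletion K)), absRestrictNormalHom E (τ : absoluteGaloisGroup (w.adicCompletion K)) = 1 →
      τ ∈ N := fun τ hτ x hx ↦ by
    have h := hE _ hτ
    simp only [Set.mem_iInter, SetLike.mem_coe, mem_oneCocycleKer_iff] at h
    exact h x hx
  obtain ⟨g, hg⟩ := absInertia_exists_eq_mul_zpow (w.adicCompletion K) hℓ N hNd E hNE
  -- values at `g` detect the classes of `S`
  have hdet : ∀ x ∈ S, ∀ y ∈ S, (z x).1 g = (z y).1 g → x = y := by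
    intro x hx y hy hxy
    -- the restricted cocycles agree on `I`
    have hI' : ∀ σ : ↥(absInertia (w.adicCompletion K)), (z x).1 σ = (z y).1 σ := fun σ ↦ by
      obtain ⟨n, ν, hν, hσ⟩ := hg σ
      have e1 : ∀ u ∈ S, (z u).1 (σ : absoluteGaloisGroup (w.adicCompletion K)) = n • (z u).1 g := by
        intro u hu
        rw [hσ, Subgroup.coe_mul, W.cocycle_apply_mul_of_mem_absInertia p hw hgood (z u) ν.2,
          (hNmem ν).1 hν u hu, zero_add, Subgroup.coe_zpow,
          W.cocycle_apply_zpow_of_mem_absInertia p hw hgood (z u) g.2]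
      rw [e1 x hx, e1 y hy, hxy]
    have hres : resSubgroup ((W.primaryTorsionGaloisRep p).restrict (absGaloisRestrict K (w.adicCompletion K))).toTopRep (absInertia (w.adicCompletion K)) 1 x =
        resSubgroup ((W.primaryTorsionGaloisRep p).restrict (absGaloisRestrict K (w.adicCompletion K))).toTopRep (absInertia (w.adicCompletion K)) 1 y := by
      rw [← hz x, ← hz y, resSubgroup_oneCocycleClass, resSubgroup_oneCocycleClass]
      congr 1
      exact Subtype.ext (ContinuousMap.ext fun σ ↦ by
        rw [resSubgroup_pullback_apply, resSubgroup_pullback_apply]; exact hI' σ)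
    exact W.resSubgroup_absInertia_injective_primaryTorsion p hw hgood hres
  -- count
  let ev : ↥S → {y : PrimaryTorsion (geomPoints W) p //
      Nat.card (W.reductionAt w).toAffine.Point • y = 0 ∧
        W.primaryTorsionGaloisRep p (absGaloisRestrict K (w.adicCompletion K) φ) y =
          (Nat.card (IsLocalRing.ResidueField (w.adicCompletionIntegers K)) : ℤ) • y} :=
    fun x ↦ ⟨(z x.1).1 g, hval x.1 g.2⟩
  have hev : Function.Injective ev := fun x y h ↦
    Subtype.ext (hdet x.1 x.2 y.1 y.2 (congrArg Subtype.val h))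
  rw [← Nat.card_eq_finsetCard]
  exact Nat.card_le_card_of_injective ev hev

/-- **`H¹(K_w, E[p^∞])` is finite at a place `w ∤ p` of good reduction.**
[cite: GreenbergLNM1716, §2 (p. 71, "H¹(K_v, E[p^∞]) is finite" for v ∤ p)] [cite: Castella2018, Prop. 2.5] -/
theorem finite_h1_primaryTorsion (hw : ((p : ℕ) : 𝓞 K) ∉ w.asIdeal) (hgood : W.HasGoodReductionAt w) :
    Finite (continuousCohomology 1 ((W.primaryTorsionGaloisRep p).restrict
      (absGaloisRestrict K (w.adicCompletion K))).toTopRep) := by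
  obtain ⟨φ, hφ⟩ := WeierstrassCurve.exists_isFrobPow_one_adicCompletion (K := K) w
  haveI := W.finite_target p φ (w := w)
  by_contra hinf
  rw [not_finite_iff_infinite] at hinf
  obtain ⟨S, hS⟩ := Infinite.exists_subset_card_eq
    (continuousCohomology 1 ((W.primaryTorsionGaloisRep p).restrict
      (absGaloisRestrict K (w.adicCompletion K))).toTopRep)
    (Nat.card {y : PrimaryTorsion (geomPoints W) p //
      Nat.card (W.reductionAt w).toAffine.Point • y = 0 ∧
        W.primaryTorsionGaloisRep p (absGaloisRestrict K (w.adicCompletion K) φ) y =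
          (Nat.card (IsLocalRing.ResidueField (w.adicCompletionIntegers K)) : ℤ) • y} + 1)
  have h := W.finset_card_le_natCard_target p hw hgood hφ S
  omega

/-- **`#H¹(K_w, E[p^∞]) ≤ #{y ∈ E[p^∞] | #Ẽ_w(k_w)·y = 0 ∧ ρ(φ) y = q_w·y}`** at a good place `w ∤ p`,
for any arithmetic Frobenius lift `φ`. [cite: GreenbergLNM1716, §2 (p. 71)] [cite: Castella2018, Prop. 2.5] -/
theorem natCard_h1_primaryTorsion_le (hw : ((p : ℕ) : 𝓞 K) ∉ w.asIdeal) (hgood : W.HasGoodReductionAt w)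
    {φ : absoluteGaloisGroup (w.adicCompletion K)} (hφ : IsFrobPow φ 1) :
    Nat.card (continuousCohomology 1 ((W.primaryTorsionGaloisRep p).restrict
      (absGaloisRestrict K (w.adicCompletion K))).toTopRep) ≤
      Nat.card {y : PrimaryTorsion (geomPoints W) p //
        Nat.card (W.reductionAt w).toAffine.Point • y = 0 ∧
          W.primaryTorsionGaloisRep p (absGaloisRestrict K (w.adicCompletion K) φ) y =
            (Nat.card (IsLocalRing.ResidueField (w.adicCompletionIntegers K)) : ℤ) • y} := by
  haveI := W.finite_h1_primaryTorsion p hw hgood (w := w)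
  letI := Fintype.ofFinite (continuousCohomology 1 ((W.primaryTorsionGaloisRep p).restrict
      (absGaloisRestrict K (w.adicCompletion K))).toTopRep)
  have h := W.finset_card_le_natCard_target p hw hgood hφ Finset.univ
  rwa [Finset.card_univ, ← Nat.card_eq_fintype_card] at h

end WeierstrassCurve

end
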